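import Literature.Geometry.Lorentzian.HarmonicallyFlatDecay
import Mathlib.Analysis.SpecialFunctions.SmoothTransition
import Mathlib.Analysis.SpecialFunctions.Sqrt
import HarnessLib

/-!
# Smooth symbols at infinity: bilinear pairings, the radius, square roots

Complements to the `O_k(r^a)` calculus of smooth symbols at infinity (`IsBigOSmooth`,
`DecaySymbols.lean`, `DecaySymbolsCalculus.lean`, `HarmonicallyFlatDecay.lean`), needed to read
off the decay of explicit chart components built from `‖y‖`, square roots and rational operations
(the Kerr–Schild radius `r`, `r² = ½((ρ² − a²) + √((ρ² − a²)² + 4a²z²))`, and the functions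
`H = M r³/(r⁴ + a² z²)`, `ℓ` of the Kerr metric, `KerrSchildDecay.lean`):

* `IsBigOSmooth.bilin` — **Leibniz rule for a continuous bilinear pairing**:
  `B(f, g) ∈ O_k(r^{a+b})` for `f ∈ O_k(r^a)`, `g ∈ O_k(r^b)` (Mathlib's
  `ContinuousLinearMap.norm_iteratedFDerivWithin_le_of_bilinear`; `IsBigOSmooth.smul` is the case
  `B = •`);
* `isBigOSmooth_norm_sq`, `isBigOSmooth_norm` — `‖y‖² ∈ O_k(r²)`, `‖y‖ ∈ O_k(r)` on a real inner
  product space, to every order;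
* `IsBigOSmooth.tendsto_zero` — symbols of negative order tend to `0` at infinity;
* `IsBigOSmooth.inv_of_tendsto` — `1/f ∈ O_k(1)` for `f ∈ O_k(1)` with a nonzero limit;
* `IsBigOSmooth.sqrt` — **`√f ∈ O_k(1)` for `f ∈ O_k(1)` with `f → 1`** (`IsBigOSmooth.comp_contDiff`
  with a smooth function agreeing with `√·` on `[1/2, ∞)`), and `√f → 1`
  (`IsBigOSmooth.tendsto_sqrt_one`);
* `IsBigOSmooth.of_bilinForm_apply` — a field of bilinear forms on a finite-dimensional inner
  product space whose components against an orthonormal basis are symbols is a symbol.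

Everything is proved; no definitions; `[folklore]` calculus.

## References

* R. Bartnik, *The mass of an asymptotically flat manifold*, CPAM 39 (1986), Def. 2.1 (weighted
  decay classes).
* R. Schoen, S.-T. Yau, *On the proof of the positive mass conjecture in general relativity*,
  Comm. Math. Phys. 65 (1979), §1, (1.1).
-/

noncomputable section

open Set Filter Asymptotics Bornology Topology
open scoped ContDiff RealInnerProductSpace

namespace Literature.Geometry.Lorentzian

namespace IsBigOSmooth

variable {E : Type*} [NormedAddCommGroup E] [NormedSpace ℝ E]
  {W₁ : Type*} [NormedAddCommGroup W₁] [NormedSpace ℝ W₁]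
  {W₂ : Type*} [NormedAddCommGroup W₂] [NormedSpace ℝ W₂]
  {W₃ : Type*} [NormedAddCommGroup W₃] [NormedSpace ℝ W₃]
  {k : ℕ} {a b : ℝ}

/-! ### Bilinear pairings -/

/-- **Leibniz rule for a continuous bilinear pairing.** If `f ∈ O_k(r^a)` (valued in `W₁`),
`g ∈ O_k(r^b)` (valued in `W₂`) and `B : W₁ × W₂ → W₃` is a continuous bilinear map, then
`y ↦ B(f y, g y) ∈ O_k(r^{a+b})`: `‖∂^m B(f, g)‖ ≤ ‖B‖ Σ (m choose i) ‖∂^i f‖ ‖∂^{m-i} g‖`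
(Mathlib's `ContinuousLinearMap.norm_iteratedFDerivWithin_le_of_bilinear` on the open far region)
and `r^{a-i} r^{b-(m-i)} = r^{a+b-m}`. [folklore] -/
theorem bilin (B : W₁ →L[ℝ] W₂ →L[ℝ] W₃) {f : E → W₁} {g : E → W₂} (hf : IsBigOSmooth k a f)
    (hg : IsBigOSmooth k b g) : IsBigOSmooth k (a + b) fun y ↦ B (f y) (g y) := by
  obtain ⟨⟨R₁, hR₁⟩, hfO⟩ := hf
  obtain ⟨⟨R₂, hR₂⟩, hgO⟩ := hg
  set s : Set E := {y | max R₁ R₂ < ‖y‖} with hs_def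
  have hs : IsOpen s := isOpen_setOf_lt_norm _
  have hfs : ContDiffOn ℝ ∞ f s := hR₁.mono (setOf_lt_norm_anti (le_max_left _ _))
  have hgs : ContDiffOn ℝ ∞ g s := hR₂.mono (setOf_lt_norm_anti (le_max_right _ _))
  refine ⟨⟨max R₁ R₂, (B.contDiff.comp_contDiffOn hfs).clm_apply hgs⟩, fun m hm ↦ ?_⟩
  -- the Leibniz bound on the far region
  have key : ∀ y ∈ s, ‖iteratedFDeriv ℝ m (fun y ↦ B (f y) (g y)) y‖ ≤
      ‖B‖ * ∑ i ∈ Finset.range (m + 1), (m.choose i : ℝ) * ‖iteratedFDeriv ℝ i f y‖ *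
        ‖iteratedFDeriv ℝ (m - i) g y‖ := by
    intro y hy
    calc ‖iteratedFDeriv ℝ m (fun y ↦ B (f y) (g y)) y‖
        = ‖iteratedFDerivWithin ℝ m (fun y ↦ B (f y) (g y)) s y‖ := by
          rw [iteratedFDerivWithin_of_isOpen m hs hy]
      _ ≤ ‖B‖ * ∑ i ∈ Finset.range (m + 1), (m.choose i : ℝ) *
            ‖iteratedFDerivWithin ℝ i f s y‖ * ‖iteratedFDerivWithin ℝ (m - i) g s y‖ :=
          B.norm_iteratedFDerivWithin_le_of_bilinear hfs hgs hs.uniqueDiffOn hy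
            (natCast_le_infty m)
      _ = _ := by
          congr 1
          refine Finset.sum_congr rfl fun i _ ↦ ?_
          rw [iteratedFDerivWithin_of_isOpen i hs hy, iteratedFDerivWithin_of_isOpen (m - i) hs hy]
  -- each Leibniz term is `O(r^{a+b-m})`
  have hterm : ∀ i ∈ Finset.range (m + 1),
      (fun y ↦ (m.choose i : ℝ) * ‖iteratedFDeriv ℝ i f y‖ * ‖iteratedFDeriv ℝ (m - i) g y‖)
        =O[cobounded E] fun x ↦ ‖x‖ ^ (a + b - m) := by
    intro i hi
    have him : i ≤ m := Nat.lt_succ_iff.1 (Finset.mem_range.1 hi)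
    have h1 := (hfO i (him.trans hm)).const_mul_left (m.choose i : ℝ)
    have h2 := hgO (m - i) ((Nat.sub_le m i).trans hm)
    refine (h1.mul h2).trans (EventuallyEq.isBigO ?_)
    refine (norm_rpow_mul_rpow_eventuallyEq (E := E) (a - i) (b - (m - i : ℕ))).trans ?_
    refine Eventually.of_forall fun x ↦ ?_
    rw [Nat.cast_sub him]
    ring_nf
  have hsum := (IsBigO.sum hterm).const_mul_left ‖B‖
  have H : ∀ᶠ y in cobounded E, ‖iteratedFDeriv ℝ m (fun y ↦ B (f y) (g y)) y‖ ≤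
      ‖B‖ * ∑ i ∈ Finset.range (m + 1), (m.choose i : ℝ) * ‖iteratedFDeriv ℝ i f y‖ *
        ‖iteratedFDeriv ℝ (m - i) g y‖ := by
    filter_upwards [eventually_cobounded_lt_norm (E := E) (max R₁ R₂)] with y hy
    exact key y hy
  exact (IsBigO.of_norm_eventuallyLE
    (H.mono fun x hx ↦ (Real.norm_of_nonneg (norm_nonneg _)).trans_le hx)).trans hsum

/-- Bilinear pairings of symbols of order `0`. [folklore] -/
theorem bilin₀ (B : W₁ →L[ℝ] W₂ →L[ℝ] W₃) {f : E → W₁} {g : E → W₂} (hf : IsBigOSmooth k 0 f)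
    (hg : IsBigOSmooth k 0 g) : IsBigOSmooth k 0 fun y ↦ B (f y) (g y) := by
  simpa only [add_zero] using hf.bilin B hg

/-- **Operator-valued symbols applied to vector-valued symbols**: if `F ∈ O_k(r^a)` takes values in
`W₁ →L W₂` and `f ∈ O_k(r^b)` takes values in `W₁`, then `y ↦ F(y) (f y) ∈ O_k(r^{a+b})` (the
bilinear pairing "evaluation"). [folklore] -/
theorem clm_apply {F : E → W₁ →L[ℝ] W₂} {f : E → W₁} (hF : IsBigOSmooth k a F)
    (hf : IsBigOSmooth k b f) : IsBigOSmooth k (a + b) fun y ↦ F y (f y) :=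
  hF.bilin (ContinuousLinearMap.id ℝ (W₁ →L[ℝ] W₂)) hf

/-! ### Limits at infinity -/

/-- **Symbols of negative order tend to zero at infinity** (the order-zero bound
`‖f(x)‖ = O(‖x‖^a)` with `a < 0`). [folklore] -/
theorem tendsto_zero {f : E → W₁} (hf : IsBigOSmooth k a f) (ha : a < 0) :
    Tendsto f (cobounded E) (𝓝 0) := by
  have h0 := hf.isBigO (m := 0) (Nat.zero_le _)
  simp only [norm_iteratedFDeriv_zero, Nat.cast_zero, sub_zero] at h0
  have h1 : Tendsto (fun x : E ↦ ‖x‖ ^ a) (cobounded E) (𝓝 0) := by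
    have h := (tendsto_rpow_neg_atTop (by linarith : 0 < -a)).comp (tendsto_norm_cobounded_atTop (E := E))
    refine h.congr fun x ↦ ?_
    simp [neg_neg]
  exact tendsto_zero_iff_norm_tendsto_zero.2 (h0.trans_tendsto h1)

/-- A symbol of negative order added to a constant tends to that constant. [folklore] -/
theorem tendsto_const_add {f : E → W₁} (hf : IsBigOSmooth k a f) (ha : a < 0) (c : W₁) :
    Tendsto (fun y ↦ c + f y) (cobounded E) (𝓝 c) := by
  simpa using tendsto_const_nhds.add (hf.tendsto_zero ha)

/-! ### Reciprocals with a nonzero limit -/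

/-- **Reciprocals of scalar symbols with a nonzero limit**: if `f ∈ O_k(1)` and `f → c ≠ 0` at
infinity then `1/f ∈ O_k(1)` (`IsBigOSmooth.inv` applied to `c⁻¹ f → 1`). [folklore] -/
theorem inv_of_tendsto {f : E → ℝ} (hf : IsBigOSmooth k 0 f) {c : ℝ}
    (hc : Tendsto f (cobounded E) (𝓝 c)) (hc0 : c ≠ 0) :
    IsBigOSmooth k 0 fun y ↦ (f y)⁻¹ := by
  have h1 : Tendsto (fun y ↦ c⁻¹ * f y) (cobounded E) (𝓝 1) := by
    simpa [inv_mul_cancel₀ hc0] using hc.const_mul c⁻¹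
  have h := ((hf.const_mul c⁻¹).inv h1).const_mul c⁻¹
  refine h.congr fun y ↦ ?_
  rw [mul_inv, inv_inv, ← mul_assoc, inv_mul_cancel₀ hc0, one_mul]

omit [NormedSpace ℝ E] in
/-- The reciprocal of a scalar symbol with limit `c ≠ 0` tends to `c⁻¹`. [folklore] -/
theorem tendsto_inv {f : E → ℝ} {c : ℝ} (hc : Tendsto f (cobounded E) (𝓝 c)) (hc0 : c ≠ 0) :
    Tendsto (fun y ↦ (f y)⁻¹) (cobounded E) (𝓝 c⁻¹) :=
  hc.inv₀ hc0

/-! ### Square roots -/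

/-- **Square roots of scalar symbols tending to `1`.** If `f ∈ O_k(1)` with `f → 1` at infinity,
then `√f ∈ O_k(1)`: far out `f ≥ 1/2`, where `√f = √(φ ∘ f)` for the smooth cut-off
`φ(t) = 1/4 + (t − 1/4) χ(4t − 1)` (`χ` Mathlib's `Real.smoothTransition`; `φ ≥ 1/4`, `φ(t) = t`
for `t ≥ 1/2`), and smooth functions of bounded symbols are symbols (`IsBigOSmooth.comp_contDiff`,
Faà di Bruno). [folklore] -/
theorem sqrt {f : E → ℝ} (hf : IsBigOSmooth k 0 f) (h1 : Tendsto f (cobounded E) (𝓝 1)) :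
    IsBigOSmooth k 0 fun y ↦ √(f y) := by
  -- the smooth cut-off `φ`
  set φ : ℝ → ℝ := fun t ↦ 1 / 4 + (t - 1 / 4) * Real.smoothTransition (4 * t - 1) with hφ_def
  have hφ : ContDiff ℝ ∞ φ := by
    have h4 : ContDiff ℝ ∞ fun t : ℝ ↦ 4 * t - 1 := (contDiff_const.mul contDiff_id).sub contDiff_const
    have hχ : ContDiff ℝ ∞ fun t : ℝ ↦ Real.smoothTransition (4 * t - 1) :=
      Real.smoothTransition.contDiff.comp h4
    exact contDiff_const.add ((contDiff_id.sub contDiff_const).mul hχ)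
  have hφ_ge : ∀ t, 1 / 4 ≤ φ t := fun t ↦ by
    simp only [hφ_def]
    rcases le_or_gt t (1 / 4) with h | h
    · rw [Real.smoothTransition.zero_of_nonpos (by linarith)]
      linarith
    · have h0 := Real.smoothTransition.nonneg (4 * t - 1)
      nlinarith
  have hφ_id : ∀ t : ℝ, 1 / 2 ≤ t → φ t = t := fun t ht ↦ by
    simp only [hφ_def]
    rw [Real.smoothTransition.one_of_one_le (by linarith)]
    ring
  have hg : ContDiff ℝ ∞ fun t ↦ √(φ t) := hφ.sqrt fun t ↦ by linarith [hφ_ge t]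
  have hcomp := hf.comp_contDiff (g := fun t ↦ √(φ t)) hg
  have hval : ∀ᶠ x in cobounded E, 1 / 2 < f x := h1 (Ioi_mem_nhds (by norm_num))
  obtain ⟨R₁, hR₁⟩ := exists_radius_of_eventually_cobounded hval
  exact hcomp.congr_far (R₁ := R₁) fun y hy ↦ by
    simp only [hφ_id (f y) (hR₁ y hy).le]

omit [NormedSpace ℝ E] in
/-- The square root of a function tending to `1` tends to `1`. [folklore] -/
theorem tendsto_sqrt_one {f : E → ℝ} (h1 : Tendsto f (cobounded E) (𝓝 1)) :
    Tendsto (fun y ↦ √(f y)) (cobounded E) (𝓝 1) := by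
  have h := (Real.continuous_sqrt.tendsto 1).comp h1
  rw [Real.sqrt_one] at h
  exact h

end IsBigOSmooth

/-! ### The radius -/

section Norm

variable {E' : Type*} [NormedAddCommGroup E'] [InnerProductSpace ℝ E']

/-- **`‖y‖²` is a symbol of order `2`** to every order (the bilinear pairing `⟪y, y⟫` of the
order-one symbol `y ↦ y` with itself). [folklore] -/
theorem isBigOSmooth_norm_sq (k : ℕ) : IsBigOSmooth k 2 fun y : E' ↦ ‖y‖ ^ 2 := by
  have h1 := isBigOSmooth_clm_apply (ContinuousLinearMap.id ℝ E') k
  have h := h1.bilin (innerSL ℝ : E' →L[ℝ] E' →L[ℝ] ℝ) h1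
  rw [show (1 : ℝ) + 1 = 2 by norm_num] at h
  exact h.congr fun y ↦ by
    show ⟪y, y⟫ = ‖y‖ ^ 2
    exact real_inner_self_eq_norm_sq y

/-- **`‖y‖` is a symbol of order `1`** to every order (`‖y‖ = ‖y‖² · ‖y‖⁻¹` away from the origin).
[folklore] -/
theorem isBigOSmooth_norm (k : ℕ) : IsBigOSmooth k 1 fun y : E' ↦ ‖y‖ := by
  have h := (isBigOSmooth_norm_sq (E' := E') k).mul (isBigOSmooth_inv_norm_all k)
  rw [show (2 : ℝ) + -1 = 1 by norm_num] at h
  refine h.congr_far (R₁ := 0) fun y hy ↦ ?_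
  have hy0 : ‖y‖ ≠ 0 := hy.ne'
  field_simp

/-- `‖y‖⁻¹ ^ n` is a symbol of order `-n` to every order. [folklore] -/
theorem isBigOSmooth_inv_norm_pow (k n : ℕ) : IsBigOSmooth k (-(n : ℝ)) fun y : E' ↦ ‖y‖⁻¹ ^ n := by
  induction n with
  | zero => simpa using isBigOSmooth_const (E := E') k (1 : ℝ)
  | succ n ih =>
      have h := ih.mul (isBigOSmooth_inv_norm_all (E' := E') k)
      rw [show (-(n : ℝ)) + -1 = -((n + 1 : ℕ) : ℝ) by push_cast; ring] at h
      exact h.congr fun y ↦ by rw [pow_succ]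

end Norm

/-! ### Fields of bilinear forms from their components -/

section BilinForm

variable {E : Type*} [NormedAddCommGroup E] [NormedSpace ℝ E]
  {V : Type*} [NormedAddCommGroup V] [InnerProductSpace ℝ V] {ι : Type*} [Fintype ι]

omit [Fintype ι] in
/-- The elementary bilinear form `(innerSL u).smulRight (innerSL u')` is `(v, w) ↦ ⟪u, v⟫ ⟪u', w⟫`.
[folklore] -/
theorem smulRight_innerSL_apply (u u' v w : V) :
    (innerSL ℝ u).smulRight (innerSL ℝ u') v w = ⟪u, v⟫ * ⟪u', w⟫ := by
  simp

/-- **Expansion of a continuous bilinear form in an orthonormal basis**: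
`F(v, w) = Σᵢⱼ F(bᵢ, bⱼ) ⟪bᵢ, v⟫ ⟪bⱼ, w⟫`. [folklore] -/
theorem bilinForm_eq_sum_smulRight_innerSL (b : OrthonormalBasis ι ℝ V) (F : V →L[ℝ] V →L[ℝ] ℝ) :
    F = ∑ i, ∑ j, F (b i) (b j) • (innerSL ℝ (b i)).smulRight (innerSL ℝ (b j)) := by
  ext v w
  calc F v w = F (∑ i, ⟪b i, v⟫ • b i) (∑ j, ⟪b j, w⟫ • b j) := by
        rw [b.sum_repr' v, b.sum_repr' w]
    _ = ∑ i, ∑ j, F (b i) (b j) * (⟪b i, v⟫ * ⟪b j, w⟫) := by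
        simp only [map_sum, map_smul, _root_.sum_apply, _root_.smul_apply, smul_eq_mul,
          Finset.mul_sum]
        conv_rhs => rw [Finset.sum_comm]
        refine Finset.sum_congr rfl fun i _ ↦ Finset.sum_congr rfl fun j _ ↦ ?_
        ring
    _ = (∑ i, ∑ j, F (b i) (b j) • (innerSL ℝ (b i)).smulRight (innerSL ℝ (b j))) v w := by
        simp only [_root_.sum_apply, _root_.smul_apply, smul_eq_mul, smulRight_innerSL_apply]

/-- **A field of bilinear forms whose components are symbols is a symbol**: if every component
`y ↦ F(y)(bᵢ, bⱼ)` against an orthonormal basis is in `O_k(r^a)`, so is `y ↦ F(y)` (expansion in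
the basis, finite sums and constant multiples of symbols). [folklore] -/
theorem IsBigOSmooth.of_bilinForm_apply {k : ℕ} {a : ℝ} (b : OrthonormalBasis ι ℝ V)
    {F : E → V →L[ℝ] V →L[ℝ] ℝ} (hF : ∀ i j, IsBigOSmooth k a fun y ↦ F y (b i) (b j)) :
    IsBigOSmooth k a F := by
  have h : IsBigOSmooth k a fun y ↦
      ∑ i, ∑ j, F y (b i) (b j) • (innerSL ℝ (b i)).smulRight (innerSL ℝ (b j)) :=
    IsBigOSmooth.finset_sum _ fun i _ ↦ IsBigOSmooth.finset_sum _ fun j _ ↦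
      (hF i j).smul_const _
  exact h.congr fun y ↦ (bilinForm_eq_sum_smulRight_innerSL b (F y)).symm

end BilinForm

end Literature.Geometry.Lorentzian

end
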